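import Literature.IUT.HodgeArakelov.GMonoidFrobenioids
import Literature.IUT.HodgeArakelov.TemperedThetaMonoids
import Literature.AlgebraicGeometry.Frobenioids.ModelFrobenioidMap
import HarnessLib

/-!
# [IUTchII] Definition 3.8 (i): «the isomorphism of monoids … may be interpreted as an isomorphism of Frobenioids» —
# functoriality of the model Frobenioid of a `G`-monoid in equivariant homomorphisms, and the §3 instances

S. Mochizuki, *Inter-universal Teichmüller theory II*, §3, kurims manuscript (Dec. 2020), Definition 3.8 (i) p. 112
l. 47 – p. 113 l. 57, (ii) p. 113 l. 58 – p. 114 l. 77 [cite: Mochizuki2012, Def 3.8 p.112] (pages = kurims preprint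
render IUTchII-kurims-url-5036b4059555; D-0012 claim key, status disputed — nothing of the series is asserted): (i)
«… gives rise to a `p_v`-adic Frobenioid … `F_cns(M^Θ_*)`; `F_{†C_v}` … equipped with natural isomorphisms
`F_cns(M^Θ_*) ⥲ F_cns(M^Θ_*(†F_v)) ⥲ F_cns(†F_v)`, `F_{†C_v} ⥲ †C_v`, i.e. the isomorphism of monoids of Proposition
3.3, (ii), may be interpreted as an isomorphism of Frobenioids `†C_v ⥲ F_cns(M^Θ_*)`»; (ii) «isomorphisms of split
Frobenioids `F_{†F^Θ_v,α} ⥲ F^ι_env(M^Θ_*)`».  S. Mochizuki, *The geometry of Frobenioids I*, Kyushu J. Math. **62**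
(2008), Thm. 5.2 (i) p. 100, Prop. 5.3 p. 103 [cite: MochizukiFrdI2008, Prop. 5.3 p.103] («the functors that arise
naturally from the construction»).

abc-iut cell, MERGE-MAP register row **R-Def38-a** (plan/L6/MERGE-MAP.md §8S; L6-lead §F v1.19aw (3) split: (A) the
def-bearing `GMonoidFrobenioids.lean` — LANDED p455796 by abc-iut-w4-d019 g5 under the 15:40Z fallback; (B) proof-only
`GMonoidFrobenioidsDef38Proofs.lean`, w4-d019).  THIS FILE (seat abc-iut-L6-t7 gen 4, the register's writer) = the
DATA that (B)'s «Frobenioid-level isos» need and that no proof-only file can carry: a functor is data.  CLASS (b)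
CONSTRUCTION over FROZEN vocabulary consumed BY NAME (nothing re-declared): abc-iut-w4-d019's `CoveringMonoid.invariants
/ pull / rep / invariantsFunctor / divisorFunctor / ratFnFunctor / divB / frobenioid / ofStable` (p455796),
abc-iut-L6-t2's `KummerStructures.CoveringMonoid` and `TemperedThetaMonoids.ThetaEnvData` (p404874), abc-iut-L5-t2's
`SemiGraphs.CosetCat`, abc-iut-L1-t2's `Frobenioids.ModelFrobenioid.DataHom` / `DataHom.functor` / `associatesMap` /
`MonGp.map` / `gpApp` ([FrdI] Thm 5.2 (i), Prop 5.3).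

WHAT IS CONSTRUCTED:
* `CoveringMonoid.trivialObj M X = (G/U, 0)` (the Frobenius-trivial object over `G/U`); `nonempty_frobenioid`;
  `divB_of` — `Div_B [x] = [mk x]` on the image of `x ∈ Ψ^U`;
* for a `G`-EQUIVARIANT homomorphism of monoids `φ : Ψ → Ψ'` (`hφ : φ (g·x) = g·φ x`): `invariantsHom` (`Ψ^U → Ψ'^U`),
  `invariantsNatTrans : M.invariantsFunctor ⟶ M'.invariantsFunctor` (naturality = equivariance, PROVED),
  `divisorNatTrans` (classes to classes), **`dataHomOfEquivariant : DataHom M.divB M'.divB`** (the square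
  `Div_B' ∘ φ^gp = η^gp ∘ Div_B` PROVED) and **`frobenioidMap φ hφ : M.frobenioid ⥤ M'.frobenioid`** — abc-iut-L1's
  `DataHom.functor` `(G/U, α) ↦ (G/U, η^gp α)`; `frobenioidMap_obj_base` (it lies over the identity of `𝓑(G)⁰`).
  This is the referent of «the isomorphism of monoids … may be interpreted as an isomorphism of Frobenioids»: an
  equivariant ISOMORPHISM `Ψ ≅ Ψ'` gives `frobenioidMap` both ways (the inverse laws are (B)'s to state);
* at abc-iut-L6-t2's [IUTchII] Prop 3.1 data `E : ThetaEnvData P` (module `lim_J H¹(…)` with the conjugation action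
  `conj` of `Π_X(M^Θ_*)`): `ThetaEnvData.constantCovering E h` — `Π_X(M^Θ_*) ↷ Ψ_cns(M^Θ_*)` as a `G`-monoid, `h` =
  the printed conjugation-stability clause (`Prop31Statements.constants_stable`) BY NAME; **`ThetaEnvData.Fcns E h`**
  — `F_cns(M^Θ_*)` at the monoid level over `𝓑(Π_X(M^Θ_*))⁰ = CosetCat P`; for any submonoid `S ⊆ lim_J H¹(…)`
  stable under a subgroup `Q ≤ Π_X(M^Θ_*)` (the theta monoids `Ψ^ι_env(M^Θ_*)` under the stabiliser of `ι`, print's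
  `G_v(M^Θ_*▶) ↷ Ψ^ι_env(M^Θ_*)` of Def 3.8 (ii)): `coveringOfStable`, **`frobenioidOfStable`**; both inhabited.
HONEST LIMITS: (1) `ThetaEnvData` carries no topology on `P`; the Frobenioid constructions bind `[TopologicalSpace P]`
(for `Π_X(M^Θ_*)` the profinite topology); (2) print's «≅ ℚ_{≥0}» / «≅ ℕ» clauses, the `ModelFrobenioid.Hypotheses`,
and the INHABITATION of the naming record `Def38Frobenioids` are (B)'s (abc-iut-w4-d019), not done here; (3) the
FIELD-level referent at the genuine producers (abc-iut-L1-t4 `PadicFrd.Datum.perf` over `GaloisValDatum.fieldFunctor`)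
is a different object, not identified with `Fcns` here.  No `instance`, no `Prop`-valued definition, no sorry;
typed ≠ proved; nothing here bears on [IUTchIII] Cor. 3.12.
-/

noncomputable section

namespace Literature.IUT.HodgeArakelov

open CategoryTheory Opposite Function
open Literature.AlgebraicGeometry.Frobenioids Literature.AnabelianGeometry.SemiGraphs

universe u v

namespace CoveringMonoid

variable {G : Type u} [Group G] [TopologicalSpace G] (M : CoveringMonoid.{u, v} G)

/-! ### 1. The Frobenius-trivial objects; `Div_B` on generators -/

/-- The object `(G/U, 0)` of the model Frobenioid of `G ↷ Ψ` («the Frobenius-trivial object over `G/U`», [FrdI]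
Def 1.2 (v); [IUTchII] Def 3.8 (i) `F_cns(M^Θ_*)` is built from such data). [cite: MochizukiFrdI2008, Thm. 5.2(i) p.100] -/
def trivialObj (X : CosetCat G) : M.frobenioid := ⟨X, 1⟩

/-- `trivialObj X` lies over `G/U`. [cite: MochizukiFrdI2008, Thm. 5.2(i) p.100] -/
theorem baseFunctor_trivialObj (X : CosetCat G) :
    (ModelFrobenioid.baseFunctor M.divisorFunctor M.ratFnFunctor M.divB).obj (M.trivialObj X) = X := rfl

/-- The model Frobenioid of a `G`-monoid is inhabited (by `(G/G, 0)`). [cite: Mochizuki2012, Def 3.8 (i) p.112] -/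
theorem nonempty_frobenioid : Nonempty M.frobenioid := ⟨M.trivialObj CosetCat.top⟩

/-- `Div_B` on the image of `x ∈ Ψ^U` in `B(G/U) = (Ψ^U)^gp` is the image of its class `mk x ∈ Φ(G/U)`.
[cite: MochizukiFrdI2008, Thm. 5.2(i) p.100] -/
theorem divB_of (X : (CosetCat G)ᵒᵖ) (x : M.invariants ((unop X).sg : Subgroup G)) :
    AlgebraicGeometry.Frobenioids.divB M.divisorFunctor M.ratFnFunctor M.divB X (Algebra.GrothendieckGroup.of x) =
      Algebra.GrothendieckGroup.of (Associates.mk x) :=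
  MonGp.map_of _ x

/-! ### 2. Functoriality in `G`-equivariant homomorphisms of monoids -/

section Functoriality

variable {M} {M' : CoveringMonoid.{u, v} G} (φ : M.O →* M'.O) (hφ : ∀ (g : G) (x : M.O), φ (M.act g x) = M'.act g (φ x))

omit [TopologicalSpace G] in
include hφ in
/-- An equivariant homomorphism carries `U`-invariants to `U`-invariants. [cite: Mochizuki2012, Def 3.8 (i) p.112] -/
theorem map_mem_invariants {U : Subgroup G} {x : M.O} (hx : x ∈ M.invariants U) : φ x ∈ M'.invariants U :=
  fun u hu => by rw [← hφ, hx u hu]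

omit [TopologicalSpace G] in
/-- The restriction `Ψ^U → Ψ'^U` of an equivariant homomorphism. [cite: Mochizuki2012, Def 3.8 (i) p.112] -/
def invariantsHom (U : Subgroup G) : M.invariants U →* M'.invariants U :=
  (φ.restrict (M.invariants U)).codRestrict _ fun x => map_mem_invariants φ hφ x.2

omit [TopologicalSpace G] in
/-- Values of `invariantsHom`. [cite: Mochizuki2012, Def 3.8 (i) p.112] -/
@[simp] theorem invariantsHom_coe (U : Subgroup G) (x : M.invariants U) : (invariantsHom φ hφ U x : M'.O) = φ x := rfl

/-- **The morphism of monoids on `𝓑(G)⁰` induced by an equivariant homomorphism `Ψ → Ψ'`** (naturality with respect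
to the pull-backs `CoveringMonoid.pull` = equivariance, PROVED). [cite: Mochizuki2012, Def 3.8 (i) p.112] -/
def invariantsNatTrans : M.invariantsFunctor ⟶ M'.invariantsFunctor where
  app X := CommMonCat.ofHom (invariantsHom φ hφ ((unop X).sg : Subgroup G))
  naturality X Y f := by
    apply CommMonCat.hom_ext
    apply MonoidHom.ext
    intro x
    apply Subtype.ext
    change φ (M.act (rep f.unop) (Subtype.val x)) = M'.act (rep f.unop) (φ (Subtype.val x))
    exact hφ _ _

/-- Components of `invariantsNatTrans`. [cite: Mochizuki2012, Def 3.8 (i) p.112] -/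
theorem invariantsNatTrans_app (X : (CosetCat G)ᵒᵖ) :
    ((invariantsNatTrans φ hφ).app X).hom = invariantsHom φ hφ ((unop X).sg : Subgroup G) := rfl

/-- The induced morphism of divisor monoids `Φ → Φ'` (classes to classes: `associatesMap` of the components).
[cite: Mochizuki2012, Def 3.8 (i) p.112] -/
def divisorNatTrans : M.divisorFunctor ⟶ M'.divisorFunctor where
  app X := CommMonCat.ofHom (associatesMap ((invariantsNatTrans φ hφ).app X).hom)
  naturality X Y f := by
    apply CommMonCat.hom_ext
    apply MonoidHom.ext
    intro x
    obtain ⟨a, rfl⟩ := Associates.mk_surjective x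
    exact congrArg Associates.mk
      (congrArg (fun h => (CommMonCat.Hom.hom h) a) ((invariantsNatTrans φ hφ).naturality f))

/-- Components of `divisorNatTrans` on classes. [cite: Mochizuki2012, Def 3.8 (i) p.112] -/
theorem divisorNatTrans_app_mk (X : (CosetCat G)ᵒᵖ) (x : M.invariants ((unop X).sg : Subgroup G)) :
    ((divisorNatTrans φ hφ).app X).hom (Associates.mk x) = Associates.mk (invariantsHom φ hφ _ x) := rfl

/-- **The morphism of model data `(Φ, B, Div_B) → (Φ', B', Div_B')` induced by an equivariant homomorphism**:
`η` = `divisorNatTrans` (classes of `φ`), `β = φ^gp` on invariants; the square `Div_B' ∘ β = η^gp ∘ Div_B` commutes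
since both paths are the groupification of `x ↦ mk (φ x)` (PROVED). [cite: MochizukiFrdI2008, Prop. 5.3 p.103] -/
def dataHomOfEquivariant : ModelFrobenioid.DataHom M.divB M'.divB where
  η := divisorNatTrans φ hφ
  β := Functor.whiskerRight (invariantsNatTrans φ hφ) MonGp.functor
  comm A u := by
    have key : (gpApp (divisorNatTrans φ hφ) A).comp (AlgebraicGeometry.Frobenioids.divB _ _ M.divB A) =
        (AlgebraicGeometry.Frobenioids.divB _ _ M'.divB A).comp
          ((Functor.whiskerRight (invariantsNatTrans φ hφ) MonGp.functor).app A).hom := by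
      change (MonGp.map (associatesMap (invariantsHom φ hφ ((unop A).sg : Subgroup G)))).comp
          (MonGp.map (Associates.mkMonoidHom : M.invariants ((unop A).sg : Subgroup G) →* _)) =
        (MonGp.map (Associates.mkMonoidHom : M'.invariants ((unop A).sg : Subgroup G) →* _)).comp
          (MonGp.map (invariantsHom φ hφ ((unop A).sg : Subgroup G)))
      rw [← MonGp.map_comp, ← MonGp.map_comp]
      exact congrArg MonGp.map (MonoidHom.ext fun x => rfl)
    exact DFunLike.congr_fun key u

/-- **«The isomorphism of monoids … may be interpreted as an isomorphism of Frobenioids»** (Def 3.8 (i)): the functor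
of model Frobenioids `F(G ↷ Ψ) ⥤ F(G ↷ Ψ')` induced by a `G`-equivariant homomorphism `Ψ → Ψ'` — abc-iut-L1's
`DataHom.functor` («the functors that arise naturally from the construction», [FrdI] Prop 5.3):
`(G/U, α) ↦ (G/U, η^gp α)`, `(d, f, Div, u) ↦ (d, f, η Div, φ^gp u)`. [cite: Mochizuki2012, Def 3.8 (i) p.113] -/
def frobenioidMap : M.frobenioid ⥤ M'.frobenioid := (dataHomOfEquivariant φ hφ).functor

/-- `frobenioidMap` lies over the identity of the base `𝓑(G)⁰`. [cite: Mochizuki2012, Def 3.8 (i) p.113] -/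
theorem frobenioidMap_obj_base (X : M.frobenioid) : ((frobenioidMap φ hφ).obj X).base = X.base := rfl

/-- `frobenioidMap` carries the Frobenius-trivial object over `G/U` to the Frobenius-trivial object over `G/U`.
[cite: Mochizuki2012, Def 3.8 (i) p.113] -/
theorem frobenioidMap_obj_trivialObj (X : CosetCat G) :
    (frobenioidMap φ hφ).obj (M.trivialObj X) = M'.trivialObj X := by
  change (⟨X, gpApp (divisorNatTrans φ hφ) (op X) 1⟩ : M'.frobenioid) = ⟨X, 1⟩
  rw [map_one]

/-- `frobenioidMap` preserves Frobenius degrees (it is `(d, f, Div, u) ↦ (d, f, η Div, φ^gp u)`).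
[cite: Mochizuki2012, Def 3.8 (i) p.113] -/
theorem degFr_frobenioidMap_map {X Y : M.frobenioid} (f : X ⟶ Y) :
    ModelFrobenioid.degFr ((frobenioidMap φ hφ).map f) = ModelFrobenioid.degFr f := rfl

/-- `frobenioidMap` preserves the projections to the base (it lies over `𝟭`). [cite: Mochizuki2012, Def 3.8 (i) p.113] -/
theorem baseMap_frobenioidMap_map {X Y : M.frobenioid} (f : X ⟶ Y) :
    ModelFrobenioid.baseMap ((frobenioidMap φ hφ).map f) = ModelFrobenioid.baseMap f := rfl

end Functoriality

end CoveringMonoid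

/-! ### 3. [IUTchII] §3: `F_cns(M^Θ_*)` and the Frobenioids of the stable monoids of a `ThetaEnvData` -/

namespace TemperedThetaMonoids.ThetaEnvData

variable {P : Type u} [Group P] (E : ThetaEnvData.{u, v} P)

/-- **`Π_X(M^Θ_*) ↷ Ψ_cns(M^Θ_*)` as a `G`-monoid** (Def 3.8 (i) «the monoid equipped with a `Π_X(M^Θ_*)`-action
`Π_X(M^Θ_*) ↷ Ψ_cns(M^Θ_*)`»), cut out of `lim_J H¹(…)` by the constant monoid of Prop 3.1 (ii) and its printed
conjugation-stability (`Prop31Statements.constants_stable`, the hypothesis `h` BY NAME; abc-iut-w4-d019's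
`CoveringMonoid.ofStable`). [cite: Mochizuki2012, Def 3.8 (i) p.112] -/
abbrev constantCovering (h : E.IsConjStable E.constantMonoid) : CoveringMonoid.{u, v} P :=
  CoveringMonoid.ofStable E.conj E.constantMonoid h

/-- For a submonoid `S ⊆ lim_J H¹(…)` stable under a subgroup `Q ≤ Π_X(M^Θ_*)` — the theta monoids `Ψ^ι_env(M^Θ_*)`
under the stabiliser of `ι`, print's «topological group action `G_v(M^Θ_*▶) ↷ Ψ^ι_env(M^Θ_*)`» (Def 3.8 (ii)) —
the `Q`-monoid `Q ↷ S` (action restricted along `Q ≤ Π_X(M^Θ_*)`). [cite: Mochizuki2012, Def 3.8 (ii) p.113] -/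
abbrev coveringOfStable (S : Submonoid E.H) (Q : Subgroup P)
    (hS : ∀ (g : Q) (x : E.H), x ∈ S → E.conj g x ∈ S) : CoveringMonoid.{u, v} Q :=
  CoveringMonoid.ofStable (E.conj.comp Q.subtype) S hS

/-- The stability hypothesis of `coveringOfStable` from a membership-style clause (`∀ g ∈ Q, …`).
[cite: Mochizuki2012, Def 3.8 (ii) p.113] -/
theorem stable_of_forall_mem (S : Submonoid E.H) (Q : Subgroup P)
    (hS : ∀ g ∈ Q, ∀ x : E.H, x ∈ S → E.conj g x ∈ S) : ∀ (g : Q) (x : E.H), x ∈ S → E.conj g x ∈ S :=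
  fun g x hx => hS g g.2 x hx

variable [TopologicalSpace P]

/-- **`F_cns(M^Θ_*)`** at the monoid level: the model Frobenioid over `𝓑(Π_X(M^Θ_*))⁰ = CosetCat P` of
`Π_X(M^Θ_*) ↷ Ψ_cns(M^Θ_*)` (Def 3.8 (i) «gives rise to a `p_v`-adic Frobenioid … `F_cns(M^Θ_*)`»; the «≅ ℚ_{≥0}»
clause is its perfection, not applied here). [cite: Mochizuki2012, Def 3.8 (i) p.112] -/
abbrev Fcns (h : E.IsConjStable E.constantMonoid) : Type (max u v) := (E.constantCovering h).frobenioid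

/-- `F_cns(M^Θ_*)` is inhabited (the Frobenius-trivial object over `Π/Π`). [cite: Mochizuki2012, Def 3.8 (i) p.112] -/
theorem nonempty_Fcns (h : E.IsConjStable E.constantMonoid) : Nonempty (E.Fcns h) :=
  (E.constantCovering h).nonempty_frobenioid

omit [TopologicalSpace P] in
/-- The value of the divisor-monoid data of `F_cns(M^Θ_*)` at `Π/U`: the `U`-invariants of `Ψ_cns(M^Θ_*)` are the
constants fixed by `conj(U)`. [cite: Mochizuki2012, Def 3.8 (i) p.112] -/
theorem mem_invariants_constantCovering_iff (h : E.IsConjStable E.constantMonoid) (U : Subgroup P)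
    (x : E.constantMonoid) :
    x ∈ (E.constantCovering h).invariants U ↔ ∀ u ∈ U, E.conj u (x : E.H) = (x : E.H) :=
  CoveringMonoid.mem_invariants_ofStable_iff E.conj E.constantMonoid h U x

/-- **The Frobenioid of a `Q`-stable monoid** over `𝓑(Q)⁰` (Def 3.8 (ii): `F^ι_env(M^Θ_*)` for `S = Ψ^ι_env(M^Θ_*)`;
likewise `F_ξ(M^Θ_*)` for a value-profile monoid, with `Q` the acting group). [cite: Mochizuki2012, Def 3.8 (ii) p.113] -/
abbrev frobenioidOfStable (S : Submonoid E.H) (Q : Subgroup P)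
    (hS : ∀ (g : Q) (x : E.H), x ∈ S → E.conj g x ∈ S) : Type (max u v) :=
  (E.coveringOfStable S Q hS).frobenioid

/-- The Frobenioid of a stable monoid is inhabited. [cite: Mochizuki2012, Def 3.8 (ii) p.113] -/
theorem nonempty_frobenioidOfStable (S : Submonoid E.H) (Q : Subgroup P)
    (hS : ∀ (g : Q) (x : E.H), x ∈ S → E.conj g x ∈ S) : Nonempty (E.frobenioidOfStable S Q hS) :=
  (E.coveringOfStable S Q hS).nonempty_frobenioid

/-- **«Isomorphisms of Frobenioids from isomorphisms of monoids»** at the §3 data: an inclusion `S ≤ S'` of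
`Q`-stable submonoids (e.g. `Ψ^ι_env ⊆ ∞Ψ^ι_env`, `Prop31.thetaMonoid_le_infty`) induces the functor of Frobenioids
`F(Q ↷ S) ⥤ F(Q ↷ S')` over `𝓑(Q)⁰` (`frobenioidMap` of the equivariant inclusion). [cite: Mochizuki2012, Def 3.8 (ii) p.113] -/
def frobenioidMapOfLE {S S' : Submonoid E.H} {Q : Subgroup P} (hS : ∀ (g : Q) (x : E.H), x ∈ S → E.conj g x ∈ S)
    (hS' : ∀ (g : Q) (x : E.H), x ∈ S' → E.conj g x ∈ S') (hle : S ≤ S') :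
    E.frobenioidOfStable S Q hS ⥤ E.frobenioidOfStable S' Q hS' :=
  CoveringMonoid.frobenioidMap (M := E.coveringOfStable S Q hS) (M' := E.coveringOfStable S' Q hS')
    (Submonoid.inclusion hle) fun _ _ => rfl

end TemperedThetaMonoids.ThetaEnvData

end Literature.IUT.HodgeArakelov

end
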